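import Summits.SmoothPoincare4.SmoothPoincare4.Theorems.AcyclicBisectionExists.Negative.OneSided
import Literature.Topology.FourManifolds.Handles
import Literature.Topology.FourManifolds.MorseHomologyVanishing
import Literature.Topology.FourManifolds.ImmersionOrientation
import Literature.Topology.FourManifolds.HomotopyS4OrientableProofs
import Literature.Topology.FourManifolds.BoundaryGluingRelHomology
import Literature.Topology.FourManifolds.RelFundamentalClassOfOrientation
import Literature.AlgebraicTopology.SingularHomology.LefschetzDualityProofs
import Literature.AlgebraicTopology.SingularHomology.UniversalCoefficientsField

/-!
# Homological bookkeeping of a NICE SPLITTING `M = A ∪_φ B` of a homotopy 4-sphere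
(stub `stub_niceSplittingBookkeeping` of line `modp-braid-orbits`, reshape r8, crux
`ConvexBisection.AcyclicBisectionExists`, item stmt-SmoothPoincare4-10508, route route-SmoothPoincare4-ConvexBisection)

A *nice splitting* of a closed smooth 4-manifold `M` is a boundary gluing `M = A ∪_φ B`
(`IsBoundaryGluing bA bB φ (𝓡 4) M`) of a compact 2-handlebody `A` (`IsHandlebodyOfIndexLE 3 2 A`) and a
compact upside-down 1-handlebody `B` (`IsHandlebodyOfIndexLE 3 1 B`); every closed smooth 4-manifold has one
(tree `exists_handlebody_boundaryGluing_of_isSelfIndexing`).  Over `M ≃ₕ S⁴` we prove, with ℚ coefficients: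
the seam is nonempty; `A`, `B`, `∂A` are connected (`H₁(M, jA A) ≅ H₁(B, ∂B) ≅ H³(B) = 0` makes
`H₀(A) → H₀(M) ≅ ℚ` injective and `H₀` detects components; dually; `H₁(A, ∂A) ≅ H³(A) = 0` for the seam);
and **`H₁(A; ℚ) = 0`** (`H₂(M, jA A) → H₁(jA A) → H₁(M) = 0` with `H₂(M, jA A) ≅ H₂(B, ∂B) ≅ H²(B) = 0`:
excision for the gluing, Lefschetz duality for the orientation of `B` pulled back from `M`, field UCT,
Morse vanishing — `B` has no `2`-handles).  These are the vocabulary-free inputs of the dictionary stub of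
the line.  Everything is proved from tree theorems; no definitions, no named facts.
-/

noncomputable section

-- the prescribed namespace `Summit.<P>.<Sub>.…` duplicates `SmoothPoincare4` (P = Sub)
set_option linter.dupNamespace false

open scoped Manifold ContDiff Topology ContinuousMap
open Set Function CategoryTheory CategoryTheory.Limits
open Literature.AlgebraicTopology.SingularHomology Literature.Topology.FourManifolds

namespace Summit.SmoothPoincare4.SmoothPoincare4.Theorems.AcyclicBisectionExists.ModpBraidOrbits

open Summit.SmoothPoincare4.SmoothPoincare4.Theorems.AcyclicBisectionExists.Negative

/-! ## Generalities: connectedness of homotopy spheres, Lefschetz and Morse vanishing, `H₀` -/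

/-- **A homotopy 4-sphere is connected**: `e_* : H₀(M; ℚ) ≅ H₀(S⁴; ℚ)` is injective and all point classes of
the path connected `S⁴` agree, so all point classes of `M` agree, and `H₀` detects components
(`preconnectedSpace_of_pointClass_eq`). [folklore] -/
theorem connectedSpace_of_homotopyEquiv_sphere {M : Type} [TopologicalSpace M]
    [ChartedSpace (EuclideanSpace ℝ (Fin 4)) M] (e : M ≃ₕ Metric.sphere (0 : EuclideanSpace ℝ (Fin 5)) 1) : ConnectedSpace M := by
  haveI : Nonempty M := ⟨e.invFun ⟨EuclideanSpace.single 0 1, by simp⟩⟩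
  haveI : LocallyPathConnectedSpace M :=
    ChartedSpace.locallyPathConnectedSpace (EuclideanSpace ℝ (Fin 4)) M
  haveI : PathConnectedSpace (Metric.sphere (0 : EuclideanSpace ℝ (Fin 5)) 1) := by
    refine isPathConnected_iff_pathConnectedSpace.mp (isPathConnected_sphere ?_ 0 zero_le_one)
    rw [← Module.finrank_eq_rank, finrank_euclideanSpace_fin]
    exact Nat.one_lt_cast.mpr (by norm_num)
  have hinj : Function.Injective (singularHomology.map ℚ ℚ e.toFun 0) :=
    (ModuleCat.mono_iff_injective _).mp
      (inferInstance : Mono (singularHomology.isoOfHomotopyEquiv ℚ ℚ e 0).hom)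
  haveI : PreconnectedSpace M := preconnectedSpace_of_pointClass_eq fun z z' => hinj (by
    rw [map_pointClass, map_pointClass]
    exact pointClass_eq_of_pathConnectedSpace _ _)
  exact ⟨‹_›⟩

section Lefschetz

variable {W : Type} [TopologicalSpace W] [T2Space W] [SecondCountableTopology W] [CompactSpace W]
  [ChartedSpace (EuclideanHalfSpace 4) W] [IsManifold (𝓡∂ 4) ∞ W]

/-- **Lefschetz vanishing on an ORIENTABLE compact 4-manifold with (nonempty, abstractly presented)
boundary**: if `Hₚ(W; ℚ) = 0` and `p + q = 4` then `H_q(W, ∂W; ℚ) = 0`.  The smooth orientation gives an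
integral relative fundamental class of the null-cobordism `W` of `b.carrier`
(`NullCobordism.exists_isRelFundamentalClass_of_smoothOrientation`), hence a ℚ one
(`ExtCollar.exists_isRelFundamentalClass_of_orientation`); then `Hᵖ(W; ℚ) → H_q(W, ∂W; ℚ)` is a
bijection (Hatcher Thm 3.43, tree `bijective_relCapProduct_of_isRelFundamentalClass_holds`) and
`Hᵖ(W; ℚ) ↪ Hₚ(W; ℚ)^* = 0` (`kroneckerPairing_injective_of_field`).  This is the disprover's
`Negative.Witness.isZero_relHomology₂` with the Stein orientation replaced by any orientation. [folklore] -/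
theorem isZero_relHomology_of_isOrientable (b : BoundaryData (𝓡∂ 4) W (𝓡 3)) [Nonempty b.carrier]
    (ho : IsOrientable (𝓡∂ 4) W) {p q : ℕ} (hpq : p + q = 4)
    (hp : IsZero (singularHomology ℚ ℚ W p)) :
    IsZero (relativeSingularHomology ℚ ℚ W ((𝓡∂ 4).boundary W) q) := by
  obtain ⟨o⟩ := ho
  -- bridging instances at `2 + 1 + 1` / `2 + 1`
  letI i1 : ChartedSpace (EuclideanHalfSpace (2 + 1 + 1)) W := ‹ChartedSpace (EuclideanHalfSpace 4) W›
  letI i2 : IsManifold (𝓡∂ (2 + 1 + 1)) ∞ W := ‹IsManifold (𝓡∂ 4) ∞ W›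
  letI i3 : ChartedSpace (EuclideanSpace ℝ (Fin (2 + 1))) b.carrier := b.chartedSpace
  letI i4 : IsManifold (𝓡 (2 + 1)) ∞ b.carrier := b.isManifold
  haveI : CompactSpace b.carrier := b.compactSpace_carrier
  -- `W` as a null-cobordism of the abstract boundary `b.carrier`, and its ℚ fundamental class
  let c₀ : NullCobordism (2 + 1) b.carrier :=
    { W := W
      incl := b.incl
      isSmoothEmbedding_incl := b.isSmoothEmbedding
      range_incl := b.range_incl }
  obtain ⟨z, hz⟩ := c₀.exists_isRelFundamentalClass_of_smoothOrientation o
  obtain ⟨zq, hzq⟩ := ExtCollar.exists_isRelFundamentalClass_of_orientation (R := ℚ) (2 + 1)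
    ((ExtCollar.orientation z hz).toCoeff ℚ)
  have h : p + q = 2 + 1 + 1 := hpq
  have hbij := bijective_relCapProduct_of_isRelFundamentalClass_holds (R := ℚ) (2 + 1) W zq hzq h
  -- `Hᵖ(W; ℚ)` is trivial, hence so is the target of the duality bijection
  haveI : Subsingleton (singularHomology ℚ ℚ W p) := ModuleCat.subsingleton_of_isZero hp
  have hsub : Subsingleton (singularCohomology ℚ ℚ W p) :=
    ⟨fun a c => kroneckerPairing_injective_of_field ℚ W p
      (LinearMap.ext fun x => by rw [Subsingleton.elim x 0, map_zero, map_zero])⟩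
  haveI : Subsingleton (relativeSingularHomology ℚ ℚ W ((𝓡∂ (2 + 1 + 1)).boundary W) q) :=
    ⟨fun x y => by
      obtain ⟨a, rfl⟩ := hbij.2 x
      obtain ⟨c, rfl⟩ := hbij.2 y
      rw [Subsingleton.elim a c]⟩
  exact ModuleCat.isZero_of_subsingleton _

/-- **A compact 4-dimensional `k`-handlebody has no homology above degree `k`** (Milnor 1963, Thm 3.5 /
§5: the adapted Morse function has no critical point of index `j > k`; tree
`IsMorseAdapted.isZero_singularHomology_of_forall_morseIndex_ne`). [folklore] -/
theorem isZero_homology_of_isHandlebodyOfIndexLE {k j : ℕ} (hW : IsHandlebodyOfIndexLE 3 k W)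
    (hj : k < j) : IsZero (singularHomology ℚ ℚ W j) := by
  obtain ⟨f, hf, hind⟩ := hW
  exact hf.isZero_singularHomology_of_forall_morseIndex_ne (R := ℚ) (M₀ := ℚ) fun z hz h =>
    absurd (hind z (mem_criticalSet.mp hz)) (by omega)

end Lefschetz

section HZeroEmbedding

variable {X Y : Type} [TopologicalSpace X] [TopologicalSpace Y]

/-- **`H₀(X) → H₀(Y)` is injective for an embedding `f : X → Y` with `H₁(Y, f X; ℚ) = 0`** (exactness of
`H₁(Y, fX) → H₀(fX) → H₀(Y)` and `X ≃ₜ f X`). [folklore] -/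
theorem injective_map_zero_of_isZero_relHomology {f : X → Y} (hf : Topology.IsEmbedding f)
    (h : IsZero (relativeSingularHomology ℚ ℚ Y (range f) 1)) :
    Function.Injective (singularHomology.map ℚ ℚ (⟨f, hf.continuous⟩ : C(X, Y)) 0) := by
  have hmono : Mono (singularHomology.map ℚ ℚ
      (⟨Subtype.val, continuous_subtype_val⟩ : C(↥(range f), Y)) 0) :=
    (relativeSingularHomology.exact_δ_map ℚ ℚ (range f) 0).mono_g (h.eq_of_src _ _)
  have hfac : (⟨f, hf.continuous⟩ : C(X, Y)) =
      (⟨Subtype.val, continuous_subtype_val⟩ : C(↥(range f), Y)).comp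
        (hf.toHomeomorph : C(X, ↥(range f))) := by
    ext x; rfl
  rw [hfac, singularHomology.map_comp]
  haveI : IsIso (singularHomology.map ℚ ℚ (hf.toHomeomorph : C(X, ↥(range f))) 0) :=
    (inferInstance : IsIso (singularHomology.mapIso ℚ ℚ hf.toHomeomorph 0).hom)
  exact (ModuleCat.mono_iff_injective _).mp (mono_comp _ _)

/-- **… hence `X` is preconnected** when `X` is locally connected and `Y` is path connected: all point
classes of `Y` agree, so all point classes of `X` agree, and `H₀` detects components. [folklore] -/
theorem preconnectedSpace_of_isZero_relHomology [LocallyConnectedSpace X] [PathConnectedSpace Y]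
    {f : X → Y} (hf : Topology.IsEmbedding f)
    (h : IsZero (relativeSingularHomology ℚ ℚ Y (range f) 1)) : PreconnectedSpace X :=
  preconnectedSpace_of_pointClass_eq fun z z' => injective_map_zero_of_isZero_relHomology hf h (by
    rw [map_pointClass, map_pointClass]
    exact pointClass_eq_of_pathConnectedSpace _ _)

end HZeroEmbedding

/-! ## The nice splitting of a homotopy 4-sphere -/

section Splitting

variable {M : Type} [TopologicalSpace M] [T2Space M] [SecondCountableTopology M]
  [ChartedSpace (EuclideanSpace ℝ (Fin 4)) M] [IsManifold (𝓡 4) ∞ M]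
  {A : Type} [TopologicalSpace A] [T2Space A] [SecondCountableTopology A] [CompactSpace A]
  [ChartedSpace (EuclideanHalfSpace 4) A] [IsManifold (𝓡∂ 4) ∞ A]
  {B : Type} [TopologicalSpace B] [T2Space B] [SecondCountableTopology B] [CompactSpace B]
  [ChartedSpace (EuclideanHalfSpace 4) B] [IsManifold (𝓡∂ 4) ∞ B]

omit [T2Space M] [SecondCountableTopology M] in
/-- **Excision for a boundary gluing, abstract boundary data**: if `M = A ∪_φ B` with witnessing
embeddings `jA`, `jB` and `∂B ≠ ∅`, then `Hₖ(B, ∂B; ℚ) = 0 ⇒ Hₖ(M, jA A; ℚ) = 0` — the tree's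
`BoundaryGluingData.isIso_map_jB_boundary'` (`(jB)_* : Hₖ(B, ∂B) ≅ Hₖ(M, jA A)`, Hatcher Thm 2.20 /
Prop 2.22) read on the null-cobordisms `A`, `B` of the abstract boundaries `bA.carrier`, `bB.carrier`.
[folklore] -/
theorem isZero_relHomology_range_of_isZero (bA : BoundaryData (𝓡∂ 4) A (𝓡 3))
    (bB : BoundaryData (𝓡∂ 4) B (𝓡 3)) [Nonempty bB.carrier] (φ : bA.carrier ≃ₘ⟮𝓡 3, 𝓡 3⟯ bB.carrier)
    {jA : A → M} {jB : B → M} (hjA : Manifold.IsSmoothEmbedding (𝓡∂ 4) (𝓡 4) ∞ jA)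
    (hjB : Manifold.IsSmoothEmbedding (𝓡∂ 4) (𝓡 4) ∞ jB) (hcover : range jA ∪ range jB = univ)
    (hR : ∀ a b, jA a = jB b ↔ ∃ z, a = bA.incl z ∧ b = bB.incl (φ z)) {k : ℕ}
    (hk : IsZero (relativeSingularHomology ℚ ℚ B ((𝓡∂ 4).boundary B) k)) :
    IsZero (relativeSingularHomology ℚ ℚ M (range jA) k) := by
  -- bridging instances at `2 + 1 + 1` / `2 + 1`
  letI iA1 : ChartedSpace (EuclideanHalfSpace (2 + 1 + 1)) A := ‹ChartedSpace (EuclideanHalfSpace 4) A›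
  letI iA2 : IsManifold (𝓡∂ (2 + 1 + 1)) ∞ A := ‹IsManifold (𝓡∂ 4) ∞ A›
  letI iB1 : ChartedSpace (EuclideanHalfSpace (2 + 1 + 1)) B := ‹ChartedSpace (EuclideanHalfSpace 4) B›
  letI iB2 : IsManifold (𝓡∂ (2 + 1 + 1)) ∞ B := ‹IsManifold (𝓡∂ 4) ∞ B›
  letI iM1 : ChartedSpace (EuclideanSpace ℝ (Fin (2 + 1 + 1))) M := ‹ChartedSpace (EuclideanSpace ℝ (Fin 4)) M›
  letI iM2 : IsManifold (𝓡 (2 + 1 + 1)) ∞ M := ‹IsManifold (𝓡 4) ∞ M›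
  letI ia3 : ChartedSpace (EuclideanSpace ℝ (Fin (2 + 1))) bA.carrier := bA.chartedSpace
  letI ia4 : IsManifold (𝓡 (2 + 1)) ∞ bA.carrier := bA.isManifold
  letI ib3 : ChartedSpace (EuclideanSpace ℝ (Fin (2 + 1))) bB.carrier := bB.chartedSpace
  letI ib4 : IsManifold (𝓡 (2 + 1)) ∞ bB.carrier := bB.isManifold
  haveI : CompactSpace bB.carrier := bB.compactSpace_carrier
  haveI : T2Space bB.carrier := bB.isSmoothEmbedding.isEmbedding.t2Space
  -- the pieces as null-cobordisms of their abstract boundaries, and the gluing data over them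
  let cA : NullCobordism (2 + 1) bA.carrier :=
    { W := A
      incl := bA.incl
      isSmoothEmbedding_incl := bA.isSmoothEmbedding
      range_incl := bA.range_incl }
  let cB : NullCobordism (2 + 1) bB.carrier :=
    { W := B
      incl := bB.incl
      isSmoothEmbedding_incl := bB.isSmoothEmbedding
      range_incl := bB.range_incl }
  let G : BoundaryGluingData cA.boundaryData cB.boundaryData φ.toEquiv M :=
    { jA := jA
      jB := jB
      isSmoothEmbedding_jA := hjA
      isSmoothEmbedding_jB := hjB
      range_union := hcover
      jA_eq_jB_iff := hR }
  haveI := G.isIso_map_jB_boundary' ℚ ℚ k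
  exact hk.of_iso (asIso (relativeSingularHomology.map ℚ ℚ
    (⟨G.jB, G.continuous_jB⟩ : C(cB.W, M)) G.mapsTo_jB_boundary k)).symm

omit [SecondCountableTopology M] [IsManifold (𝓡 4) ∞ M] in
/-- **The seam of a nice splitting of a homotopy 4-sphere is nonempty** (`∂A ≠ ∅`): otherwise the two ranges
are disjoint closed sets covering the connected `M`, so one piece is all of `M` — but a `k`-handlebody
with `k < 4` has `H₄ = 0` (Morse) while `dim H₄(M; ℚ) = 1`. [folklore] -/
theorem nonempty_seam_of_niceSplitting (e : M ≃ₕ Metric.sphere (0 : EuclideanSpace ℝ (Fin 5)) 1) (bA : BoundaryData (𝓡∂ 4) A (𝓡 3))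
    (bB : BoundaryData (𝓡∂ 4) B (𝓡 3)) (φ : bA.carrier ≃ₘ⟮𝓡 3, 𝓡 3⟯ bB.carrier)
    (hA : IsHandlebodyOfIndexLE 3 2 A) (hB : IsHandlebodyOfIndexLE 3 1 B)
    (h : IsBoundaryGluing bA bB φ (𝓡 4) M) : Nonempty bA.carrier := by
  obtain ⟨jA, jB, hjA, hjB, hcover, hR⟩ := h
  haveI := connectedSpace_of_homotopyEquiv_sphere e
  by_contra hE
  rw [not_nonempty_iff] at hE
  have hdisj : Disjoint (range jA) (range jB) := by
    rw [Set.disjoint_left]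
    rintro _ ⟨a, rfl⟩ ⟨b, hb⟩
    obtain ⟨z, -, -⟩ := (hR a b).mp hb.symm
    exact hE.elim z
  have hcompl : range jA = (range jB)ᶜ := by
    refine Set.Subset.antisymm (fun x hx => Set.disjoint_left.mp hdisj hx) fun x hx => ?_
    have hx' : x ∈ range jA ∪ range jB := hcover ▸ Set.mem_univ x
    exact hx'.resolve_right hx
  have hclopen : IsClopen (range jA) :=
    ⟨(isCompact_range hjA.isEmbedding.continuous).isClosed,
      hcompl ▸ (isCompact_range hjB.isEmbedding.continuous).isClosed.isOpen_compl⟩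
  -- `H₄(M; ℚ) ≠ 0`
  have hM4 : ¬ IsZero (singularHomology ℚ ℚ M 4) := fun h4 => by
    haveI : Subsingleton (singularHomology ℚ ℚ M 4) := ModuleCat.subsingleton_of_isZero h4
    have h1' := Witness.finrank_homology_four_of_homotopyEquiv_sphere e
    rw [Module.finrank_zero_of_subsingleton] at h1'
    exact zero_ne_one h1'
  rcases isClopen_iff.mp hclopen with h0 | h1
  · -- `jA A = ∅`: `jB` is onto, so `H₄(M) ≅ H₄(B) = 0`
    have hB1 : range jB = univ := by rw [← hcover, h0, Set.empty_union]
    let eBM : B ≃ₜ M :=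
      hjB.isEmbedding.toHomeomorph.trans ((Homeomorph.setCongr hB1).trans (Homeomorph.Set.univ M))
    exact hM4 ((isZero_homology_of_isHandlebodyOfIndexLE hB (by norm_num)).of_iso
      (singularHomology.mapIso ℚ ℚ eBM.symm 4))
  · -- `jA` is onto, so `H₄(M) ≅ H₄(A) = 0`
    let eAM : A ≃ₜ M :=
      hjA.isEmbedding.toHomeomorph.trans ((Homeomorph.setCongr h1).trans (Homeomorph.Set.univ M))
    exact hM4 ((isZero_homology_of_isHandlebodyOfIndexLE hA (by norm_num)).of_iso
      (singularHomology.mapIso ℚ ℚ eAM.symm 4))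

/-- **`H₁(A; ℚ) = 0` for the 2-handlebody side of a nice splitting of a homotopy 4-sphere.**  In the exact
`H₂(M, jA A) → H₁(jA A) → H₁(M) = 0` the left group is `H₂(B, ∂B; ℚ) ≅ H²(B; ℚ) ≅ H₂(B; ℚ)^* = 0`
(excision for the gluing, Lefschetz duality for the orientation of `B` pulled back from the orientable
`M` along `jB` — tree `isOrientable_of_homotopyEquiv_sphere_four_holds`, `IsOrientable.of_isSmoothEmbedding`
— and Morse vanishing: no `2`-handles in `B`).  Mayer–Vietoris form of Gompf–Stipsicz §4.4 /
Akbulut–Matveyev 1998 §4 ("the `3`- and `4`-handles form `♮ˡ S¹ × D³`"). [folklore] -/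
theorem isZero_homology_one_of_niceSplitting (e : M ≃ₕ Metric.sphere (0 : EuclideanSpace ℝ (Fin 5)) 1) (bA : BoundaryData (𝓡∂ 4) A (𝓡 3))
    (bB : BoundaryData (𝓡∂ 4) B (𝓡 3)) (φ : bA.carrier ≃ₘ⟮𝓡 3, 𝓡 3⟯ bB.carrier)
    (hA : IsHandlebodyOfIndexLE 3 2 A) (hB : IsHandlebodyOfIndexLE 3 1 B)
    (h : IsBoundaryGluing bA bB φ (𝓡 4) M) : IsZero (singularHomology ℚ ℚ A 1) := by
  haveI : Nonempty bB.carrier := (nonempty_seam_of_niceSplitting e bA bB φ hA hB h).map φ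
  obtain ⟨jA, jB, hjA, hjB, hcover, hR⟩ := h
  -- orientation of `B`, pulled back from `M`; `H₂(B, ∂B; ℚ) = 0`; `H₂(M, jA A; ℚ) = 0`
  have hoM : IsOrientable (𝓡 4) M := isOrientable_of_homotopyEquiv_sphere_four_holds M e
  have hoB : IsOrientable (𝓡∂ 4) B := IsOrientable.of_isSmoothEmbedding hjB hoM
  have hB2 : IsZero (singularHomology ℚ ℚ B 2) := isZero_homology_of_isHandlebodyOfIndexLE hB (by norm_num)
  have hrelB : IsZero (relativeSingularHomology ℚ ℚ B ((𝓡∂ 4).boundary B) 2) :=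
    isZero_relHomology_of_isOrientable bB hoB (p := 2) (q := 2) rfl hB2
  have hrelM : IsZero (relativeSingularHomology ℚ ℚ M (range jA) 2) :=
    isZero_relHomology_range_of_isZero bA bB φ hjA hjB hcover hR hrelB
  -- `H₁(M; ℚ) = 0`, and exactness at `H₁(jA A)`
  have hM1 : IsZero (singularHomology ℚ ℚ M 1) :=
    Witness.isZero_homology_of_homotopyEquiv_sphere e one_ne_zero (by norm_num)
  have hS : IsZero (singularHomology ℚ ℚ ↥(range jA) 1) :=
    (relativeSingularHomology.exact_δ_map ℚ ℚ (range jA) 1).isZero_of_both_zeros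
      (hrelM.eq_of_src _ _) (hM1.eq_of_tgt _ _)
  exact hS.of_iso (singularHomology.mapIso ℚ ℚ hjA.isEmbedding.toHomeomorph 1)

/-- **`A`, `B` and the seam `∂A` of a nice splitting of a homotopy 4-sphere are connected.**
`H₁(M, jA A; ℚ) ≅ H₁(B, ∂B; ℚ) ≅ H³(B; ℚ) = 0` (excision, Lefschetz, Morse: no `3`-handles in `B`), so
`H₀(A) → H₀(M) ≅ ℚ` is injective and `H₀` detects components; swapping the pieces (`M = B ∪_{φ⁻¹} A`,
no `3`-handles in `A`) gives `B`; and `H₁(A, ∂A; ℚ) ≅ H³(A; ℚ) = 0` with `A` connected gives `∂A`.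
[folklore] -/
theorem connected_of_niceSplitting (e : M ≃ₕ Metric.sphere (0 : EuclideanSpace ℝ (Fin 5)) 1) (bA : BoundaryData (𝓡∂ 4) A (𝓡 3))
    (bB : BoundaryData (𝓡∂ 4) B (𝓡 3)) (φ : bA.carrier ≃ₘ⟮𝓡 3, 𝓡 3⟯ bB.carrier)
    (hA : IsHandlebodyOfIndexLE 3 2 A) (hB : IsHandlebodyOfIndexLE 3 1 B)
    (h : IsBoundaryGluing bA bB φ (𝓡 4) M) :
    ConnectedSpace A ∧ ConnectedSpace B ∧ ConnectedSpace bA.carrier := by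
  haveI : Nonempty bA.carrier := nonempty_seam_of_niceSplitting e bA bB φ hA hB h
  haveI : Nonempty bB.carrier := ‹Nonempty bA.carrier›.map φ
  haveI : Nonempty A := ‹Nonempty bA.carrier›.map bA.incl
  haveI : Nonempty B := ‹Nonempty bB.carrier›.map bB.incl
  obtain ⟨jA, jB, hjA, hjB, hcover, hR⟩ := h
  haveI := connectedSpace_of_homotopyEquiv_sphere e
  haveI : LocallyPathConnectedSpace M :=
    ChartedSpace.locallyPathConnectedSpace (EuclideanSpace ℝ (Fin 4)) M
  haveI : PathConnectedSpace M := pathConnectedSpace_iff_connectedSpace.mpr ‹_›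
  haveI : LocallyPathConnectedSpace A := ChartedSpace.locallyPathConnectedSpace (EuclideanHalfSpace 4) A
  haveI : LocallyPathConnectedSpace B := ChartedSpace.locallyPathConnectedSpace (EuclideanHalfSpace 4) B
  haveI : LocallyPathConnectedSpace bA.carrier :=
    ChartedSpace.locallyPathConnectedSpace (EuclideanSpace ℝ (Fin 3)) bA.carrier
  -- orientations pulled back from `M`; Lefschetz + Morse: `H₁(B, ∂B; ℚ) = 0 = H₁(A, ∂A; ℚ)`
  have hoM : IsOrientable (𝓡 4) M := isOrientable_of_homotopyEquiv_sphere_four_holds M e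
  have hrelB : IsZero (relativeSingularHomology ℚ ℚ B ((𝓡∂ 4).boundary B) 1) :=
    isZero_relHomology_of_isOrientable bB (IsOrientable.of_isSmoothEmbedding hjB hoM) (p := 3) (q := 1)
      rfl (isZero_homology_of_isHandlebodyOfIndexLE hB (by norm_num))
  have hrelA : IsZero (relativeSingularHomology ℚ ℚ A ((𝓡∂ 4).boundary A) 1) :=
    isZero_relHomology_of_isOrientable bA (IsOrientable.of_isSmoothEmbedding hjA hoM) (p := 3) (q := 1)
      rfl (isZero_homology_of_isHandlebodyOfIndexLE hA (by norm_num))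
  -- `A`: `H₁(M, jA A; ℚ) = 0`
  have hMA : IsZero (relativeSingularHomology ℚ ℚ M (range jA) 1) :=
    isZero_relHomology_range_of_isZero bA bB φ hjA hjB hcover hR hrelB
  haveI hpA : PreconnectedSpace A := preconnectedSpace_of_isZero_relHomology hjA.isEmbedding hMA
  -- `B`: swap the pieces, `H₁(M, jB B; ℚ) = 0`
  have hR' : ∀ b a, jB b = jA a ↔ ∃ w, b = bB.incl w ∧ a = bA.incl (φ.symm w) := by
    intro b a
    rw [eq_comm, hR]
    constructor
    · rintro ⟨z, ha, hb⟩
      exact ⟨φ z, hb, by simpa using ha⟩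
    · rintro ⟨w, hb, ha⟩
      exact ⟨φ.symm w, ha, by simpa using hb⟩
  have hMB : IsZero (relativeSingularHomology ℚ ℚ M (range jB) 1) :=
    isZero_relHomology_range_of_isZero bB bA φ.symm hjB hjA ((union_comm _ _).trans hcover) hR' hrelA
  haveI hpB : PreconnectedSpace B := preconnectedSpace_of_isZero_relHomology hjB.isEmbedding hMB
  -- the seam: `H₁(A, ∂A; ℚ) = 0` with `∂A = bA.incl (bA.carrier)` and `A` path connected
  haveI : PathConnectedSpace A := pathConnectedSpace_iff_connectedSpace.mpr ⟨‹Nonempty A›⟩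
  rw [← bA.range_incl] at hrelA
  haveI hpS : PreconnectedSpace bA.carrier :=
    preconnectedSpace_of_isZero_relHomology bA.isSmoothEmbedding.isEmbedding hrelA
  exact ⟨⟨‹Nonempty A›⟩, ⟨‹Nonempty B›⟩, ⟨‹Nonempty bA.carrier›⟩⟩

end Splitting

/-! ## The registered stub of the line: the bookkeeping of a nice splitting, assembled -/

/-- **Stub `stub_niceSplittingBookkeeping` of line `modp-braid-orbits` (reshape r8).**  For a homotopy
4-sphere `M ≃ₕ S⁴` presented as a nice splitting `M = A ∪_φ B` (`A` a compact 2-handlebody, `B` a compact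
1-handlebody, glued along a diffeomorphism `φ : ∂A ≅ ∂B` of boundary data): the seam `∂A` is nonempty,
`A`, `B` and `∂A` are connected, and `H₁(A; ℚ) = 0` — the vocabulary-free inputs of the Harer /
Etnyre–Fuller / Baykur dictionary (achiral Lefschetz fibrations live on connected 2-handlebodies with
connected boundary; the `A`-side vanishing cycles span `H₁(F; ℚ)` because
`H₁(A; ℚ) = H₁(F; ℚ)/⟨A-cycles⟩ = 0`).  Gompf–Stipsicz §4.4 / Akbulut–Matveyev 1998 §4, Mayer–Vietoris in
the homology sphere; here from excision, Lefschetz duality and Morse vanishing. [folklore] -/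
theorem stub_niceSplittingBookkeeping :
    ∀ (M : Type) [TopologicalSpace M] [T2Space M] [SecondCountableTopology M]
      [ChartedSpace (EuclideanSpace ℝ (Fin 4)) M] [IsManifold (𝓡 4) ∞ M],
      M ≃ₕ Metric.sphere (0 : EuclideanSpace ℝ (Fin 5)) 1 →
      ∀ (A : Type) [TopologicalSpace A] [T2Space A] [SecondCountableTopology A] [CompactSpace A]
        [ChartedSpace (EuclideanHalfSpace 4) A] [IsManifold (𝓡∂ 4) ∞ A]
        (B : Type) [TopologicalSpace B] [T2Space B] [SecondCountableTopology B] [CompactSpace B]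
        [ChartedSpace (EuclideanHalfSpace 4) B] [IsManifold (𝓡∂ 4) ∞ B]
        (bA : BoundaryData (𝓡∂ 4) A (𝓡 3)) (bB : BoundaryData (𝓡∂ 4) B (𝓡 3))
        (φ₀ : bA.carrier ≃ₘ⟮𝓡 3, 𝓡 3⟯ bB.carrier),
        IsHandlebodyOfIndexLE 3 2 A → IsHandlebodyOfIndexLE 3 1 B → IsBoundaryGluing bA bB φ₀ (𝓡 4) M →
        Nonempty bA.carrier ∧ ConnectedSpace A ∧ ConnectedSpace B ∧ ConnectedSpace bA.carrier ∧
          CategoryTheory.Limits.IsZero (singularHomology ℚ ℚ A 1) := by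
  intro M _ _ _ _ _ e A _ _ _ _ _ _ B _ _ _ _ _ _ bA bB φ₀ hA hB h
  obtain ⟨hcA, hcB, hcS⟩ := connected_of_niceSplitting e bA bB φ₀ hA hB h
  exact ⟨nonempty_seam_of_niceSplitting e bA bB φ₀ hA hB h, hcA, hcB, hcS,
    isZero_homology_one_of_niceSplitting e bA bB φ₀ hA hB h⟩

end Summit.SmoothPoincare4.SmoothPoincare4.Theorems.AcyclicBisectionExists.ModpBraidOrbits

end
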